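import Summits.QuantumFields.QCD.Theorems.QuarksAsStableActionCriticalLineDiamagnetismRectFreqOpStatic
import Summits.QuantumFields.QCD.Theorems.WilsonQuarkChessboardBackgroundSchwarzGram

/-!
# Route B helper `rectPattern` for stub `stub_heavyFrequencyGain` of line `Sketch` — the frequency determinant of the
reflection-doubled SLAB PATTERN on the even time-circle
(crux `Summit.QuantumFields.QCD.Theses.QuarksAsStableAction.CriticalLineDiamagnetism`, item stmt-QuantumFields-9734,
static route for odd tori, Route B of the heavy-frequency gain, bookkeeping of the pure tiling terms of the even
chessboard)

For a field `A : ℤ/L₁ → ℤ/L₂ → Fin 4 → U(3)`, a row `t : ℤ/L₁` and `n ≥ 1`, the SLAB PATTERN of rows `t, t+1` is the field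
`pat` on the rectangular two-torus `ℤ/(2n) × ℤ/L₂` whose links along the second coordinate are those of row `t` of `A` on
even rows and of row `t + 1` on odd rows, and whose links along the first ("time") coordinate are `A(t,x,2)` on even rows,
`A(t,x,2)⁻¹` on odd rows.  Its frequency determinant in Lüscher's transfer form (`tfreqOpR_det_transfer_form` on the
`2n`-circle) reads `‖det D[pat]‖ = e_t^n · e_{t+1}^n · Re det (1 + (W̃ᴴ M_t W̃ M_{t+1})^n)` with the `W`-blind e-factors
`e_s = ‖det (A_sP⁻ − P⁺)‖` (`stub_normDetChainBlock`), the dressed one-step matrices `M_s = oneStepR A s` and the UNSIGNED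
transporter `W̃ = A(t,·,2) ⊗ 1_spin` of row `t`:

* the slice data of `pat` only read the row's links along the second coordinate (`sliceOpR_congr`, `oneStepR_congr`), so
  they alternate between those of rows `t` and `t + 1` of `A`; the e-factors multiply to `e_t^n e_{t+1}^n`
  (`n` even and `n` odd residues in `ℤ/(2n)`);
* the seam-signed transporters of `pat` are `W̃` on even rows and `W̃ᴴ` on odd rows, with the seam sign `−1` exactly on the
  (odd) row `2n − 1`, so `∏_{s<2n} M_s W_s = −(M_t W̃ M_{t+1} W̃ᴴ)^n` and `det (1 − ∏) = det (1 + (M_t W̃ M_{t+1} W̃ᴴ)^n)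
  = det (1 + (W̃ᴴ M_t W̃ M_{t+1})^n)` by the cyclic Sylvester identity;
* `det (1 + (P M)^n)` is real `≥ 1` for positive semidefinite `P = W̃ᴴ M_t W̃` and `M = M_{t+1} = Bᴴ B`
  (Sylvester again: `= det (1 + (B P Bᴴ)^n)`, and `BackgroundSchwarz.one_le_det_one_add`), so its norm is its real part.

Pure theorem file (no definitions).  References: M. Lüscher, Commun. Math. Phys. 54 (1977) 283; J. Fröhlich, R. Israel,
E. H. Lieb, B. Simon, Commun. Math. Phys. 62 (1978) 1.
-/

noncomputable section

open scoped BigOperators Matrix ComplexConjugate ComplexOrder MatrixOrder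
open Finset
open Literature.MathematicalPhysics.QuantumLattice Literature.MathematicalPhysics.QuantumFieldTheory
  Literature.Probability.LatticeModels

namespace Summit.QuantumFields.QCD.Cruxes.CriticalLineDiamagnetism.ChessboardCellGain

namespace FrequencyDiamagnetism

namespace RectPattern

open Matrix Complex
open Summit.QuantumFields.QCD.Cruxes.StableActionBridge.Sketch
open Summit.QuantumFields.QCD.Cruxes.WilsonQuarkStability.FreeTangentLandauChessboard

/-! ### Counting: products over `ℤ/N` and over even/odd positions -/

/-- For `N ≥ 1`, a product over `ZMod N` is the product over the residues of `0, 1, …, N − 1`. -/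
theorem prod_univ_zmod_eq_prod_range {M : Type*} [CommMonoid M] (N : ℕ) [NeZero N] (c : ZMod N → M) :
    ∏ s : ZMod N, c s = ∏ i ∈ Finset.range N, c (i : ZMod N) := by
  -- adapted from `SupertraceTransferForm.prod_univ_zmod_eq` (…StableActionBridgeSupertraceTransferForm.lean)
  obtain ⟨k, rfl⟩ : ∃ k, N = k + 1 := ⟨N - 1, (Nat.sub_one_add_one_eq_of_pos (NeZero.pos N)).symm⟩
  rw [← Fin.prod_univ_eq_prod_range (fun i : ℕ => c i) (k + 1)]
  exact Fintype.prod_congr _ _ fun i => congrArg c (ZMod.natCast_zmod_val (n := k + 1) i).symm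

/-- `∏_{i<2n} (a on even i, b on odd i) = a^n b^n`. -/
theorem prod_range_two_mul_ite {M : Type*} [CommMonoid M] (a b : M) :
    ∀ n : ℕ, ∏ i ∈ Finset.range (2 * n), (if i % 2 = 0 then a else b) = a ^ n * b ^ n
  | 0 => by simp
  | n + 1 => by
    rw [show 2 * (n + 1) = 2 * n + 1 + 1 by ring, Finset.prod_range_succ, Finset.prod_range_succ,
      prod_range_two_mul_ite a b n, if_pos (by omega), if_neg (by omega), pow_succ, pow_succ,
      mul_right_comm (a ^ n) (b ^ n) a, mul_assoc]

/-- Ordered products with alternating factors: `∏_{i<2k} f i = (X Y)^k` if `f (2j) = X`, `f (2j+1) = Y` (`j < k`). -/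
theorem prod_map_range_two_mul {R : Type*} [Monoid R] (X Y : R) (f : ℕ → R) :
    ∀ k : ℕ, (∀ j, j < k → f (2 * j) = X) → (∀ j, j < k → f (2 * j + 1) = Y) →
      ((List.range (2 * k)).map f).prod = (X * Y) ^ k
  | 0 => fun _ _ => by simp
  | k + 1 => fun hX hY => by
    rw [show 2 * (k + 1) = 2 * k + 1 + 1 by ring, List.prod_range_succ, List.prod_range_succ,
      prod_map_range_two_mul X Y f k (fun j hj => hX j (by omega)) (fun j hj => hY j (by omega)),
      hX k (lt_add_one k), hY k (lt_add_one k), pow_succ, mul_assoc]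

/-- Ordered products with alternating factors and a sign on the last one:
`∏_{i<2n} f i = −(X Y)^n` if `f (2j) = X` (`j < n`), `f (2j+1) = Y` (`j + 1 < n`), `f (2n−1) = −Y`, `n ≥ 1`. -/
theorem prod_map_range_two_mul_signed {R : Type*} [Ring R] (X Y : R) (f : ℕ → R) {n : ℕ} (hn : 0 < n)
    (hX : ∀ j, j < n → f (2 * j) = X) (hY : ∀ j, j + 1 < n → f (2 * j + 1) = Y) (hlast : f (2 * n - 1) = -Y) :
    ((List.range (2 * n)).map f).prod = -((X * Y) ^ n) := by
  obtain ⟨k, rfl⟩ : ∃ k, n = k + 1 := ⟨n - 1, (Nat.sub_one_add_one_eq_of_pos hn).symm⟩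
  have hl : 2 * (k + 1) - 1 = 2 * k + 1 := by omega
  rw [hl] at hlast
  rw [show 2 * (k + 1) = 2 * k + 1 + 1 by ring, List.prod_range_succ, List.prod_range_succ,
    prod_map_range_two_mul X Y f k (fun j hj => hX j (by omega)) (fun j hj => hY j (by omega)),
    hX k (lt_add_one k), hlast, mul_neg, pow_succ, mul_assoc]

/-! ### Residues of `ℤ/(2n)` -/

/-- The residue of `2n − 1` in `ℤ/(2n)` is `−1` (`n ≥ 1`). -/
theorem natCast_two_mul_sub_one {n : ℕ} (hn : 0 < n) : ((2 * n - 1 : ℕ) : ZMod (2 * n)) = -1 :=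
  APDetTransferForm.natCast_eq_neg_one (by omega)

/-- No `i < 2n − 1` has residue `−1` in `ℤ/(2n)`. -/
theorem natCast_ne_neg_one {n i : ℕ} (hn : 0 < n) (hi : i < 2 * n - 1) : ((i : ℕ) : ZMod (2 * n)) ≠ -1 :=
  APDetTransferForm.natCast_ne_neg_one (k := 2 * n - 1) (by omega) hi

/-! ### Colour lifts -/

/-- The adjoint of a colour lift `U ⊗ 1_spin` is the colour lift of the adjoints. -/
theorem conjTranspose_colourLift {L₂ : ℕ} (U : ZMod L₂ → Matrix (Fin 3) (Fin 3) ℂ) :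
    (Matrix.of fun a b : ZMod L₂ × Fin 3 × Fin 4 =>
        if a.1 = b.1 ∧ a.2.2 = b.2.2 then U a.1 a.2.1 b.2.1 else 0)ᴴ =
      Matrix.of fun a b : ZMod L₂ × Fin 3 × Fin 4 =>
        if a.1 = b.1 ∧ a.2.2 = b.2.2 then (U a.1)ᴴ a.2.1 b.2.1 else 0 := by
  -- adapted from `star_link2R'` (…CriticalLineDiamagnetismRectFreqOpStatic.lean)
  ext ⟨x, c, α⟩ ⟨y, e, β⟩
  simp only [Matrix.conjTranspose_apply, Matrix.of_apply]
  by_cases hxy : x = y ∧ α = β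
  · obtain ⟨rfl, rfl⟩ := hxy
    simp only [and_self, if_true]
  · rw [if_neg hxy, if_neg (fun h' => hxy ⟨h'.1.symm, h'.2.symm⟩), star_zero]

/-- Off the seam, the forward transporter of a row whose time links are `U` is the colour lift of `U`. -/
theorem link2R_eq_colourLift {N L₂ : ℕ} (P : ZMod N → ZMod L₂ → Fin 4 → Matrix.unitaryGroup (Fin 3) ℂ) (s : ZMod N)
    (U : ZMod L₂ → Matrix (Fin 3) (Fin 3) ℂ) (hs : s ≠ -1) (h : ∀ x, (P s x 2 : Matrix (Fin 3) (Fin 3) ℂ) = U x) :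
    link2R P s = Matrix.of fun a b : ZMod L₂ × Fin 3 × Fin 4 =>
      if a.1 = b.1 ∧ a.2.2 = b.2.2 then U a.1 a.2.1 b.2.1 else 0 := by
  simp only [link2R, if_neg hs, one_smul, h]

/-- On the seam, the forward transporter of a row whose time links are `U` is minus the colour lift of `U`. -/
theorem link2R_eq_neg_colourLift {N L₂ : ℕ} (P : ZMod N → ZMod L₂ → Fin 4 → Matrix.unitaryGroup (Fin 3) ℂ) (s : ZMod N)
    (U : ZMod L₂ → Matrix (Fin 3) (Fin 3) ℂ) (hs : s = -1) (h : ∀ x, (P s x 2 : Matrix (Fin 3) (Fin 3) ℂ) = U x) :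
    link2R P s = -(Matrix.of fun a b : ZMod L₂ × Fin 3 × Fin 4 =>
      if a.1 = b.1 ∧ a.2.2 = b.2.2 then U a.1 a.2.1 b.2.1 else 0) := by
  ext a b
  simp only [link2R, if_pos hs, h, Matrix.of_apply, Matrix.neg_apply, Matrix.smul_apply, smul_eq_mul]
  split_ifs <;> ring

/-- The inverse of a unitary colour matrix, as a matrix, is its adjoint. -/
theorem coe_inv_unitary (U : Matrix.unitaryGroup (Fin 3) ℂ) :
    ((U⁻¹ : Matrix.unitaryGroup (Fin 3) ℂ) : Matrix (Fin 3) (Fin 3) ℂ) = (U : Matrix (Fin 3) (Fin 3) ℂ)ᴴ := rfl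

/-! ### Sylvester and positivity -/

/-- Sylvester's determinant identity for powers: `det (1 + (A B)^p) = det (1 + (B A)^p)`. -/
theorem det_one_add_pow_comm {k : Type*} [Fintype k] [DecidableEq k] (A B : Matrix k k ℂ) (p : ℕ) :
    (1 + (A * B) ^ p).det = (1 + (B * A) ^ p).det := by
  -- adapted from `csp_det_one_add_pow_comm` (…CriticalLineDiamagnetismClosedSlabPackaging.lean)
  cases p with
  | zero => simp
  | succ q =>
    rw [pow_succ (A * B) q, ← Matrix.mul_assoc ((A * B) ^ q) A B, mul_pow_mul A B q,
      Matrix.mul_assoc A ((B * A) ^ q) B, Matrix.det_one_add_mul_comm A ((B * A) ^ q * B),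
      Matrix.mul_assoc ((B * A) ^ q) B A, ← pow_succ]

/-- For positive semidefinite `P`, `M`, `det (1 + (P M)^p)` is real and `≥ 1`: writing `M = Bᴴ B`, it equals
`det (1 + (B P Bᴴ)^p)`; so its norm is its real part. -/
theorem norm_det_one_add_pow_mul {k : Type*} [Fintype k] [DecidableEq k] {P M : Matrix k k ℂ}
    (hP : P.PosSemidef) (hM : M.PosSemidef) (p : ℕ) :
    ‖(1 + (P * M) ^ p).det‖ = ((1 + (P * M) ^ p).det).re := by
  obtain ⟨B, rfl⟩ := CStarAlgebra.nonneg_iff_eq_star_mul_self.mp hM.nonneg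
  have h1 : (1 + (P * (star B * B)) ^ p).det = (1 + (B * P * Bᴴ) ^ p).det := by
    rw [← Matrix.mul_assoc, det_one_add_pow_comm (P * star B) B p, Matrix.star_eq_conjTranspose, ← Matrix.mul_assoc]
  have h2 : (1 : ℂ) ≤ (1 + (B * P * Bᴴ) ^ p).det :=
    Summit.QuantumFields.QCD.Theorems.BackgroundSchwarz.one_le_det_one_add ((hP.mul_mul_conjTranspose_same B).pow p)
  have h0 : (0 : ℂ) ≤ (1 + (P * (star B * B)) ^ p).det := h1 ▸ zero_le_one.trans h2
  have h := congrArg Complex.re (Complex.norm_of_nonneg' h0)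
  rwa [Complex.ofReal_re] at h

end RectPattern

end FrequencyDiamagnetism

/-! ### The registered helper theorem -/

open FrequencyDiamagnetism FrequencyDiamagnetism.RectPattern Matrix
  Summit.QuantumFields.QCD.Cruxes.StableActionBridge.Sketch
  Summit.QuantumFields.QCD.Cruxes.WilsonQuarkStability.FreeTangentLandauChessboard in
/-- **Route B helper `rectPattern`** (the reflection-doubled slab pattern of rows `t, t+1` on the even time-circle
`ℤ/(2n)` and its frequency determinant in transfer form).  For `A : ℤ/L₁ → ℤ/L₂ → Fin 4 → U(3)`, `t : ℤ/L₁`, `n ≥ 1`,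
`m > −1` and real frequencies, the field `pat` on `ℤ/(2n) × ℤ/L₂` (links along the second coordinate: row `t` of `A`
on even rows, row `t + 1` on odd rows; links along the first coordinate: `A(t,x,2)` on even rows, `A(t,x,2)⁻¹` on odd
rows; other links trivial) satisfies
`‖det tfreqOpR pat‖ = e_t^n · e_{t+1}^n · Re det (1 + (W̃ᴴ M_t W̃ M_{t+1})^n)` with `e_s = ‖det (A_sP⁻ − P⁺)‖`,
`M_s = oneStepR A s` and the unsigned transporter `W̃ = A(t,·,2) ⊗ 1_spin` (the seam sign of `tfreqOpR` on the even circle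
turns `det (1 − ∏ M_sW_s)` into `det (1 + (M_t W̃ M_{t+1} W̃ᴴ)^n)`; Sylvester moves the letters cyclically; the last
determinant is real `≥ 1`). -/
theorem rectPattern : ∀ (n : ℕ) [NeZero n] (L₁ L₂ : ℕ) [NeZero L₁] [NeZero L₂] (A : ZMod L₁ → ZMod L₂ → Fin 4 → Matrix.unitaryGroup (Fin 3) ℂ) (t : ZMod L₁) (m : ℝ), -1 < m → ∀ ω₀ ω₁ : ℝ, let pat : ZMod (2 * n) → ZMod L₂ → Fin 4 → Matrix.unitaryGroup (Fin 3) ℂ := fun s x μ => if μ = 3 then (if s.val % 2 = 0 then A t x 3 else A (t + 1) x 3) else if μ = 2 then (if s.val % 2 = 0 then A t x 2 else (A t x 2)⁻¹) else 1; let Wt : Matrix (ZMod L₂ × Fin 3 × Fin 4) (ZMod L₂ × Fin 3 × Fin 4) ℂ := Matrix.of fun a b => if a.1 = b.1 ∧ a.2.2 = b.2.2 then (A t a.1 2 : Matrix (Fin 3) (Fin 3) ℂ) a.2.1 b.2.1 else 0; ‖(tfreqOpR pat m ω₀ ω₁).det‖ = ‖(sliceOpR A m ω₀ ω₁ t * projM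 L₂ - projP L₂).det‖ ^ n * ‖(sliceOpR A m ω₀ ω₁ (t + 1) * projM L₂ - projP L₂).det‖ ^ n * ((1 + (Wtᴴ * oneStepR A m ω₀ ω₁ t * Wt * oneStepR A m ω₀ ω₁ (t + 1)) ^ n).det).re := by
  intro n _ L₁ L₂ _ _ A t m hm ω₀ ω₁ pat Wt
  have hn : 0 < n := Nat.pos_of_ne_zero (NeZero.ne n)
  -- reading the links of the pattern
  have hp3 : ∀ s x, pat s x 3 = if s.val % 2 = 0 then A t x 3 else A (t + 1) x 3 := fun s x => rfl
  have hp2 : ∀ s x, pat s x 2 = if s.val % 2 = 0 then A t x 2 else (A t x 2)⁻¹ := fun s x => rfl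
  -- the row of `A` whose links along the second coordinate are read on row `s` of the pattern
  obtain ⟨row, hrow⟩ : ∃ row : ZMod (2 * n) → ZMod L₁, ∀ s, row s = if s.val % 2 = 0 then t else t + 1 :=
    ⟨fun s => if s.val % 2 = 0 then t else t + 1, fun s => rfl⟩
  have hrow0 : ∀ s : ZMod (2 * n), s.val % 2 = 0 → row s = t := fun s hs => by rw [hrow, if_pos hs]
  have hrow1 : ∀ s : ZMod (2 * n), s.val % 2 ≠ 0 → row s = t + 1 := fun s hs => by rw [hrow, if_neg hs]
  have hp3' : ∀ s x, pat s x 3 = A (row s) x 3 := fun s x => by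
    rw [hp3, hrow]
    split_ifs <;> rfl
  have hA : ∀ s, sliceOpR pat m ω₀ ω₁ s = sliceOpR A m ω₀ ω₁ (row s) := fun s =>
    sliceOpR_congr A pat m ω₀ ω₁ s (row s) (hp3' s)
  have hM : ∀ s, oneStepR pat m ω₀ ω₁ s = oneStepR A m ω₀ ω₁ (row s) := fun s =>
    oneStepR_congr A pat m ω₀ ω₁ s (row s) (hp3' s)
  -- Lüscher's transfer form on the `2n`-circle, positivity of the one-step matrices of `A`
  obtain ⟨hdet, -⟩ := tfreqOpR_det_transfer_form pat hm ω₀ ω₁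
  have hMpos := (tfreqOpR_det_transfer_form A hm ω₀ ω₁).2
  -- the e-factors are blind to the transporters (`stub_normDetChainBlock`)
  have hP : projP L₂ + projM L₂ = 1 := liftProjPlus_add_liftProjMinus (ZMod L₂) 3
  have hPQ : projP L₂ * projM L₂ = 0 := liftProjPlus_mul_liftProjMinus (ZMod L₂) 3
  have hQP : projM L₂ * projP L₂ = 0 := liftProjMinus_mul_liftProjPlus (ZMod L₂) 3
  have hPph : (projP L₂)ᴴ = projP L₂ := (slice_claimsR A hm ω₀ ω₁ t).2.2.1
  have hPmh : (projM L₂)ᴴ = projM L₂ := (slice_claimsR A hm ω₀ ω₁ t).2.2.2.1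
  have hsp := fun s : ZMod (2 * n) => slice_spin_structureR pat m ω₀ ω₁ s
  have hW'u : ∀ s, link2R' pat s ∈ Matrix.unitaryGroup _ ℂ := fun s =>
    Matrix.mem_unitaryGroup_iff.mpr (by rw [star_link2R', (hsp s).2.2.2.2.2.2.2.2])
  have hEV : ∀ s, ‖(sliceOpR pat m ω₀ ω₁ s * projM L₂ - projP L₂ * link2R' pat (s - 1)).det‖ =
      ‖(sliceOpR A m ω₀ ω₁ (row s) * projM L₂ - projP L₂).det‖ := fun s => by
    rw [hA s]
    exact stub_normDetChainBlock _ _ _ _ hP hPQ hQP hPph hPmh (hW'u _) (hsp (s - 1)).2.2.2.2.2.2.1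
      (hsp (s - 1)).2.2.2.2.2.2.2.1
  -- `n` even and `n` odd rows
  have hEprod : ∏ s : ZMod (2 * n), ‖(sliceOpR A m ω₀ ω₁ (row s) * projM L₂ - projP L₂).det‖ =
      ‖(sliceOpR A m ω₀ ω₁ t * projM L₂ - projP L₂).det‖ ^ n *
        ‖(sliceOpR A m ω₀ ω₁ (t + 1) * projM L₂ - projP L₂).det‖ ^ n := by
    rw [prod_univ_zmod_eq_prod_range, ← prod_range_two_mul_ite]
    refine Finset.prod_congr rfl fun i hi => ?_
    rw [hrow, ZMod.val_cast_of_lt (Finset.mem_range.1 hi)]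
    split_ifs <;> rfl
  -- the transporters of the pattern: `W̃` on even rows, `W̃ᴴ` on odd rows, `−W̃ᴴ` on the seam row `2n − 1`
  have hWt' : Wtᴴ = Matrix.of fun a b : ZMod L₂ × Fin 3 × Fin 4 =>
      if a.1 = b.1 ∧ a.2.2 = b.2.2 then (A t a.1 2 : Matrix (Fin 3) (Fin 3) ℂ)ᴴ a.2.1 b.2.1 else 0 :=
    conjTranspose_colourLift fun x => (A t x 2 : Matrix (Fin 3) (Fin 3) ℂ)
  have hval : ∀ i : ℕ, i < 2 * n → ((i : ZMod (2 * n))).val = i := fun i hi => ZMod.val_cast_of_lt hi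
  have hXf : ∀ j, j < n → oneStepR pat m ω₀ ω₁ ((2 * j : ℕ) : ZMod (2 * n)) * link2R pat ((2 * j : ℕ) : ZMod (2 * n)) =
      oneStepR A m ω₀ ω₁ t * Wt := fun j hj => by
    have hpar : ((2 * j : ℕ) : ZMod (2 * n)).val % 2 = 0 := by
      rw [hval _ (by omega)]
      omega
    rw [hM, hrow0 _ hpar, link2R_eq_colourLift pat _ (fun x => (A t x 2 : Matrix (Fin 3) (Fin 3) ℂ))
      (natCast_ne_neg_one hn (by omega)) (fun x => by rw [hp2, if_pos hpar])]
  have hYf : ∀ j, j + 1 < n →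
      oneStepR pat m ω₀ ω₁ ((2 * j + 1 : ℕ) : ZMod (2 * n)) * link2R pat ((2 * j + 1 : ℕ) : ZMod (2 * n)) =
        oneStepR A m ω₀ ω₁ (t + 1) * Wtᴴ := fun j hj => by
    have hpar : ((2 * j + 1 : ℕ) : ZMod (2 * n)).val % 2 ≠ 0 := by
      rw [hval _ (by omega)]
      omega
    rw [hM, hrow1 _ hpar, hWt', link2R_eq_colourLift pat _ (fun x => (A t x 2 : Matrix (Fin 3) (Fin 3) ℂ)ᴴ)
      (natCast_ne_neg_one hn (by omega)) (fun x => by rw [hp2, if_neg hpar, coe_inv_unitary])]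
  have hlast : oneStepR pat m ω₀ ω₁ ((2 * n - 1 : ℕ) : ZMod (2 * n)) * link2R pat ((2 * n - 1 : ℕ) : ZMod (2 * n)) =
      -(oneStepR A m ω₀ ω₁ (t + 1) * Wtᴴ) := by
    have hpar : ((2 * n - 1 : ℕ) : ZMod (2 * n)).val % 2 ≠ 0 := by
      rw [hval _ (by omega)]
      omega
    rw [hM, hrow1 _ hpar, hWt', link2R_eq_neg_colourLift pat _ (fun x => (A t x 2 : Matrix (Fin 3) (Fin 3) ℂ)ᴴ)
      (natCast_two_mul_sub_one hn) (fun x => by rw [hp2, if_neg hpar, coe_inv_unitary]), Matrix.mul_neg]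
  have hprod : ((List.range (2 * n)).map fun i : ℕ =>
      oneStepR pat m ω₀ ω₁ (i : ZMod (2 * n)) * link2R pat (i : ZMod (2 * n))).prod =
      -((oneStepR A m ω₀ ω₁ t * Wt * (oneStepR A m ω₀ ω₁ (t + 1) * Wtᴴ)) ^ n) :=
    prod_map_range_two_mul_signed _ _ _ hn hXf hYf hlast
  -- Sylvester, positivity, assembly
  have hSyl : (1 + (oneStepR A m ω₀ ω₁ t * Wt * (oneStepR A m ω₀ ω₁ (t + 1) * Wtᴴ)) ^ n).det =
      (1 + (Wtᴴ * oneStepR A m ω₀ ω₁ t * Wt * oneStepR A m ω₀ ω₁ (t + 1)) ^ n).det := by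
    rw [← Matrix.mul_assoc (oneStepR A m ω₀ ω₁ t * Wt) (oneStepR A m ω₀ ω₁ (t + 1)) Wtᴴ,
      det_one_add_pow_comm _ Wtᴴ n]
    simp only [Matrix.mul_assoc]
  have hre : ‖(1 + (Wtᴴ * oneStepR A m ω₀ ω₁ t * Wt * oneStepR A m ω₀ ω₁ (t + 1)) ^ n).det‖ =
      ((1 + (Wtᴴ * oneStepR A m ω₀ ω₁ t * Wt * oneStepR A m ω₀ ω₁ (t + 1)) ^ n).det).re :=
    norm_det_one_add_pow_mul ((hMpos t).posSemidef.conjTranspose_mul_mul_same Wt) (hMpos (t + 1)).posSemidef n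
  rw [hdet, norm_mul, norm_prod, Finset.prod_congr rfl fun s _ => hEV s, hEprod, hprod, sub_neg_eq_add, hSyl, hre]

end Summit.QuantumFields.QCD.Cruxes.CriticalLineDiamagnetism.ChessboardCellGain

end
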